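import Literature.AnabelianGeometry.EtaleTheta.TemperedFrobenioidOfThetaTwistTower
import Literature.AnabelianGeometry.EtaleTheta.Discharge.Sec3Prop34Cnst0TorsionUnitsObstructionThetaTwistTower
import Literature.AnabelianGeometry.EtaleTheta.Discharge.Sec4MuSaturatedOfRatFnTorsion
import Literature.AnabelianGeometry.EtaleTheta.Discharge.Sec3Cor38CriterionLine
import HarnessLib

/-!
# [EtTh] Def. 4.1 (iv) «`μ_N`-saturated» at the FOURTH tower model: the torsion of `B₀(Y)` over the ε-free (β) Kummer tower is the
# group of `μ_{N_n}`-VALUED constant families — cyclic, read off at one point, generated by one root of unity — and the first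
# `μ_N`-SATURATED objects of a tower model of record

S. Mochizuki, *The étale theta function …*, Publ. RIMS **45** (2009) [MochizukiEtTh2009], §1 p.13 («`K_N := K(ζ_N, …)`»), Def. 3.3 (iii)
p.73 (`B₀(Y^log) = Mero(Z^log_∞)^{Gal}`), Prop. 3.4 (ii) p.74 («`O_L^× ⥲ Ker(B₀ → Φ₀^gp)`»), Def. 4.1 (iv) PDF p.87 («`μ_N`-saturated»),
§5 p.331 (`μ_N(S)`); S. Mochizuki, *The geometry of Frobenioids II*, Def. 2.1 (i) p.16 («`μ_N(A) ≅ ℤ/Nℤ`»).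
[cite: MochizukiEtTh2009, Def 4.1 (iv) p.87]

PROOF-ONLY (theorems only; abc-iut cell, layer L2, seat abc-iut-L2-d2 gen 7; abc-iut-L2-lead R1114 first refusal «MU-TORSION@FOURTH-MODEL»
= abc-iut-L2-t3 g8's memo R-α3 / (O9) «`m : μ_N(B_N) ≃* MuN`» precondition), at this seat's `ThetaTwistTowerTempered.temperedFrobenioid R S`
(p493549).  Consumed BY NAME, nothing restated: abc-iut-L2-t3's sign-free tower `towerC₃sf` / `fst_eq_zero_of_towerC₃sf` / `levelActFnMod_apply`,
this seat's `divZeroHom_eq_diag_zpow`, abc-iut-w5-d034's `exists_cover_vSub` / `towerC₃sf_actFn_eq_one_of_mem_vSub` (abc-iut-L1-t6's `V_n`),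
abc-iut-w6-d037's `TemperedFrobenioid.isMuSaturated_of_bZero_generator` (p496075), abc-iut-L1's `isDivisorial_divisorMonoid_of_isFrobenioid`,
Mathlib's `IsCyclic.card_pow_eq_one_le` / `pow_injOn_Iio_orderOf`.
* §0 (any `GaloisAction`, any connected `G`-set `S` with a point `s₀`): every `Stab(s₀)`-invariant log-meromorphic value is attained by an
  equivariant family (`exists_bZero_of_invariant`) — Def. 3.3 (iii)'s `B₀(Y) = Mero^{Gal(Z_∞/Y)}` at a general transitive `S`
  (abc-iut-w6-d058's `…_quotient_…` forms are the case `S = G/H`; uniqueness is the tree's `bZero_ext_of_isConnectedGSet`).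
* §1 (level `n`): (M1) TORSION ⇒ `μ`-VALUED: `b^k = 1`, `k ≥ 1` ⇒ every value of `b` has trivial skeleton part (ε = 0 on the sign-free
  tower, `ℤ³` torsion-free) — and conversely `μ`-valued ⇒ `b^{N_n} = 1`, `div₀ b = 1`; (M2) on `μ`-valued constants «GRP₃′» acts through
  the level-`n` CYCLOTOMIC CHARACTER alone (`actFn_fst_of_snd_eq_one`: translations fix constants, the Kummer pairing of exponent `0`
  vanishes).
* §2 (M3) **`exists_generator_of_fixed`**: on a connected `S`, if `Stab(s₀)` fixes ONE `μ`-valued value `x₁` then for every `N ∣ ord(x₁)`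
  there is `ζ₀ ∈ B₀(S)`, `μ`-valued, `div₀ ζ₀ = 1`, `orderOf ζ₀ = N`, with EVERY `b ∈ B₀(S)`, `b^N = 1` in `zpowers ζ₀` — the N-torsion of
  `B₀(S)` is cyclic of order `N` (evaluation at `s₀` embeds the torsion into the cyclic `μ_{N_n}`; counting `IsCyclic.card_pow_eq_one_le`).
* §3 at abc-iut-L1-t6's covering `Y_n = Compat₃′/V_n` (level `n`, `V_n` acts trivially): **`exists_generator_cover_vSub`** — for every
  `N ∣ N_n = (n+1)!` the `N`-torsion of `B₀(Y_n)` is cyclic of order `N`, generated by a `μ`-valued unit; and the corollary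
  **`isMuSaturated_of_fixed`**: every object `A` of the fourth model whose base covering has a point whose stabiliser fixes a `μ`-valued value
  of order divisible by `N` IS `μ_N`-SATURATED ([FrdII] Def. 2.1 (i) via abc-iut-w6-d037; units form `exists_units_generator_of_fixed`)
  — `isMuSaturated_of_stabilizer_le_vSub`: every object over a covering with point-stabiliser in `V_m`, `m ≥ lvl`, is `μ_N`-saturated for
  all `N ∣ (lvl+1)!` (so Def. 4.1 (iv) is non-vacuous at a tower model of record, for every `N ≥ 1`, at the objects over `Y_{N−1}`).
HONEST FRAMING: class-(b) design model (NOT the tempered Frobenioid of a Tate curve; its units are exactly the level roots of unity — no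
principal units, cf. abc-iut-w5-d034's torsion-units obstruction); nothing here bears on [IUTchIII] Cor. 3.12; no side taken; typed ≠ proved.
-/

noncomputable section

namespace Literature.AnabelianGeometry.EtaleTheta

open CategoryTheory Opposite Function Literature.AlgebraicGeometry.Frobenioids Literature.AlgebraicGeometry.Frobenioids.QuasiTemperoid
  Literature.AnabelianGeometry.SemiGraphs LogDivisorModel LogDivisorModel.GaloisAction LogDivisorTower

universe u

/-! ## §0 Equivariant families on a connected `G`-set are their values at one point -/

namespace LogDivisorModel.GaloisAction

variable {Z : LogDivisorModel.{u}} {G : Type u} [Group G] (A : Z.GaloisAction G) {S : Action (Type u) G}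

/-- **`B₀(S) = Mero(Z_∞)^{Stab(s₀)}` on a CONNECTED `S`**: every log-meromorphic value fixed by the stabiliser of `s₀` is the value at
`s₀` of an equivariant family (`s = g·s₀ ↦ g·f`, well defined by the invariance). [cite: MochizukiEtTh2009, Def 3.3 (iii) p.73] -/
theorem exists_bZero_of_invariant (hS : isConnectedGSet S) (s₀ : S.V) {f : Z.Fn} (hf : f ∈ Z.logMero)
    (hinv : ∀ g : G, S.ρ g s₀ = s₀ → A.actFn g f = f) : ∃ b : A.bZero S, b.1 s₀ = f := by
  classical
  have hmul : ∀ (g h : G) (s : S.V), S.ρ (g * h) s = S.ρ g (S.ρ h s) := fun g h s => by rw [map_mul]; rfl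
  -- a chosen transporter `τ s` with `τ s · s₀ = s`
  let τ : S.V → G := fun s => (hS.2 s₀ s).choose
  have hτ : ∀ s, S.ρ (τ s) s₀ = s := fun s => (hS.2 s₀ s).choose_spec
  -- any two transporters differ by the stabiliser, so `g · f` depends only on `g · s₀`
  have hwd : ∀ g h : G, S.ρ g s₀ = S.ρ h s₀ → A.actFn g f = A.actFn h f := by
    intro g h hgh
    have h1 : S.ρ (h⁻¹ * g) s₀ = s₀ := by
      rw [hmul, hgh, ← hmul, inv_mul_cancel, map_one]; rfl
    have h2 : A.actFn h (A.actFn (h⁻¹ * g) f) = A.actFn g f := by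
      rw [← MulAut.mul_apply, ← map_mul, mul_inv_cancel_left]
    rw [← h2, hinv _ h1]
  refine ⟨⟨fun s => A.actFn (τ s) f, fun s => A.act_mem_logMero _ hf, fun g s => ?_⟩, ?_⟩
  · change A.actFn (τ (S.ρ g s)) f = A.actFn g (A.actFn (τ s) f)
    rw [← MulAut.mul_apply, ← map_mul]
    exact hwd _ _ (by rw [hτ, hmul, hτ])
  · change A.actFn (τ s₀) f = f
    have h := hwd (τ s₀) 1 (by rw [hτ, map_one]; rfl)
    rw [h, map_one, MulAut.one_apply]

end LogDivisorModel.GaloisAction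

namespace ThetaTwistTowerTempered

open LogDivisorModel.TateTowerThetaTwist TateTowerKummerTwistRShear
open TateTowerKummerTwist (N N_dvd_M)

/-! ## §1 Level `n`: torsion of `B₀(S)` = the `μ_{N_n}`-valued families; the action on them is the cyclotomic character -/

section Level

variable (n : ℕ) {S : Action (Type 0) (Compat 3 thetaShear)}

/-- **(M2) On a `μ`-valued constant `(ζ, 1)` «GRP₃′» acts through the level-`n` cyclotomic character alone**: `g·(ζ,1) = (χ_n(g)·ζ, 1)`
(translations fix constants, the Kummer pairing with the zero exponent vector vanishes). [cite: MochizukiEtTh2009, §1 p.13] -/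
theorem actFn_fst_of_snd_eq_one (g : Compat 3 thetaShear) (x : (towerC₃sf.Z n).Fn) (hx : x.1.2 = 1) :
    ((towerC₃sf.act n).actFn g x).1 = (levelCharMod n (N n) (N_dvd_M n) (g : Grp 3 thetaShear).right.1 x.1.1, 1) := by
  -- the exponent vector of the skeleton part is `0`
  have hx0 : (Multiplicative.toAdd x.1.2 : TateTowerTheta.Exp) = 0 := by
    rw [hx]
    rfl
  have hconst : x.1 ∈ (TateTowerThetaTwist.model (TateTowerKummerTwist.MuN n)).const :=
    (TateTowerThetaTwist.mem_const_iff (A := TateTowerKummerTwist.MuN n) x.1).2 ⟨by rw [hx0]; rfl, by rw [hx0]; rfl⟩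
  have h0 : ∀ κ : Fin 3 → ZMod (N n), pairing κ (Multiplicative.toAdd x.1.2 : TateTowerTheta.Exp) = 0 := fun κ => by
    rw [hx0]
    exact pairing_zero κ
  change levelActFnMod n (N n) (N_dvd_M n) (g : Grp 3 thetaShear) x.1 = _
  rw [levelActFnMod_apply, MulAut.mul_apply, MulAut.mul_apply, translAction_apply, translAut_of_const _ _ hconst,
    constAction_apply', kumActMod_apply]
  refine Prod.ext ?_ ?_
  · rw [kummerAut_fst]
    dsimp only
    rw [h0, ofAdd_zero, mul_one]
  · rw [kummerAut_snd]
    exact hx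

/-- The action preserves `μ`-valuedness. [cite: MochizukiEtTh2009, §1 p.13] -/
theorem actFn_snd_eq_one (g : Compat 3 thetaShear) (x : (towerC₃sf.Z n).Fn) (hx : x.1.2 = 1) : ((towerC₃sf.act n).actFn g x).1.2 = 1 := by
  rw [actFn_fst_of_snd_eq_one n g x hx]

/-- **(M1) TORSION ⇒ `μ`-VALUED**: if `b^k = 1` in `B₀(S)` (`k ≥ 1`) then every value of `b` has trivial skeleton part — the sign
coordinate is `0` on the ε-free tower and `⟨ϖ̈⟩ × ⟨Ü⟩ × ⟨Θ̈⟩ ≅ ℤ³` is torsion-free. [cite: MochizukiEtTh2009, Prop 3.4 p.74] -/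
theorem snd_eq_one_of_pow_eq_one {b : (towerC₃sf.act n).bZero S} {k : ℕ} (hk : 0 < k) (h : b ^ k = 1) (s : S.V) : (b.1 s).1.2 = 1 := by
  -- write the skeleton part as `ofAdd e`, `e ∈ ℤ/2 × ℤ³`
  obtain ⟨e, he⟩ : ∃ e : TateTowerTheta.Exp, (b.1 s).1.2 = Multiplicative.ofAdd e := ⟨_, rfl⟩
  -- `((b ^ k) s).1.2 = ((b s).1.2) ^ k` definitionally
  have h2 : (b.1 s).1.2 ^ k = 1 := congrArg (fun c : (towerC₃sf.act n).bZero S => (c.1 s).1.2) h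
  -- the same equation in `Multiplicative (ℤ/2 × ℤ³)` (the level's group structure on the skeleton part is this one)
  have h2' : Multiplicative.ofAdd e ^ k = (1 : Multiplicative TateTowerTheta.Exp) := by
    rw [← he]
    exact h2
  rw [← ofAdd_nsmul] at h2'
  have h3 : k • e = 0 := ofAdd_eq_one.mp h2'
  -- the sign coordinate vanishes on the ε-free tower; the three root exponents are torsion-free
  have hε : e.1 = 0 := by
    have h1 := fst_eq_zero_of_towerC₃sf n (b.1 s)
    rw [he] at h1
    exact h1
  have hk' : (k : ℤ) ≠ 0 := by exact_mod_cast hk.ne'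
  have hz : ∀ z : ℤ, k • z = 0 → z = 0 := fun z hz => by
    rw [nsmul_eq_mul] at hz
    exact (mul_eq_zero.mp hz).resolve_left hk'
  have h4 : e = 0 :=
    Prod.ext hε (Prod.ext (hz _ (congrArg (fun e : TateTowerTheta.Exp => e.2.1) h3))
      (Prod.ext (hz _ (congrArg (fun e : TateTowerTheta.Exp => e.2.2.1) h3)) (hz _ (congrArg (fun e : TateTowerTheta.Exp => e.2.2.2) h3))))
  rw [he, h4, ofAdd_zero]
  rfl

/-- **`μ`-VALUED ⇒ TORSION of exponent `N_n = (n+1)!`** (`μ_{N_n}` has exponent `N_n`). [cite: MochizukiEtTh2009, §1 p.13] -/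
theorem pow_N_eq_one_of_snd_eq_one {b : (towerC₃sf.act n).bZero S} (h : ∀ s, (b.1 s).1.2 = 1) : b ^ ((N n : ℕ+) : ℕ) = 1 := by
  have hcard : Fintype.card (TateTowerKummerTwist.MuN n) = ((N n : ℕ+) : ℕ) := by rw [Fintype.card_multiplicative, ZMod.card]
  refine Subtype.ext (funext fun s => Subtype.ext (Prod.ext ?_ ?_))
  · -- the `μ`-coordinate: `ζ ^ N_n = 1`
    change (b.1 s).1.1 ^ ((N n : ℕ+) : ℕ) = 1
    have h1 : (b.1 s).1.1 ^ Fintype.card (TateTowerKummerTwist.MuN n) = 1 := pow_card_eq_one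
    rwa [hcard] at h1
  · -- the skeleton coordinate: `1 ^ N_n = 1`
    change (b.1 s).1.2 ^ ((N n : ℕ+) : ℕ) = 1
    rw [h s, one_pow]

/-- **TORSION of `B₀(S)` ⟺ `μ`-VALUED.** [cite: MochizukiEtTh2009, Prop 3.4 p.74] -/
theorem isOfFinOrder_iff_snd_eq_one (b : (towerC₃sf.act n).bZero S) : IsOfFinOrder b ↔ ∀ s, (b.1 s).1.2 = 1 :=
  ⟨fun hb s => by
    obtain ⟨k, hk, hbk⟩ := hb.exists_pow_eq_one
    exact snd_eq_one_of_pow_eq_one n hk hbk s,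
    fun h => isOfFinOrder_iff_pow_eq_one.mpr ⟨_, PNat.pos _, pow_N_eq_one_of_snd_eq_one n h⟩⟩

/-- **A `μ`-valued family has trivial log-divisor** (`div₀ = [diag]^0`; Prop. 3.4 (ii): `μ ⊆ O_L^× = Ker(B₀ → Φ₀^gp)`).
[cite: MochizukiEtTh2009, Prop 3.4 p.74] -/
theorem divZeroHom_eq_one_of_snd_eq_one {b : (towerC₃sf.act n).bZero S} (h : ∀ s, (b.1 s).1.2 = 1) :
    (towerC₃sf.act n).divZeroHom S b = 1 := by
  have h' : ∀ s, Multiplicative.toAdd (b.1 s).1.2 = (((0 : ZMod 2), (0 : ℤ), (0 : ℤ), (0 : ℤ)) : TateTowerTheta.Exp) := fun s => by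
    rw [h s]
    rfl
  exact (divZeroHom_eq_diag_zpow n h').trans (zpow_zero _)

/-! ## §2 (M3) The `N`-torsion of `B₀(S)` is cyclic of order `N`, generated by one `μ`-valued family -/

/-- **Evaluation at `s₀` detects torsion elements through their `μ`-coordinate**: two `μ`-valued families with the same root of unity at
`s₀` are equal. [cite: MochizukiEtTh2009, Def 3.3 (iii) p.73] -/
theorem eq_of_snd_eq_one_of_fst_eq (hS : isConnectedGSet S) (s₀ : S.V) {b c : (towerC₃sf.act n).bZero S} (hb : ∀ s, (b.1 s).1.2 = 1)
    (hc : ∀ s, (c.1 s).1.2 = 1) (h : (b.1 s₀).1.1 = (c.1 s₀).1.1) : b = c := by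
  -- an equivariant family on one orbit is its value at `s₀` (abc-iut's `GaloisAction.bZero_ext_of_isConnectedGSet`, inlined)
  have h0 : b.1 s₀ = c.1 s₀ := Subtype.ext (Prod.ext h ((hb s₀).trans (hc s₀).symm))
  refine Subtype.ext (funext fun s => ?_)
  obtain ⟨g, rfl⟩ := hS.2 s₀ s
  rw [b.2.2 g s₀, c.2.2 g s₀, h0]

/-- Powers of a `μ`-valued family are `μ`-valued, with `μ`-coordinate the power. [cite: MochizukiEtTh2009, §1 p.13] -/
theorem zpow_apply_fst {ζ₀ : (towerC₃sf.act n).bZero S} (hζ : ∀ s, (ζ₀.1 s).1.2 = 1) (k : ℤ) (s : S.V) :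
    ((ζ₀ ^ k).1 s).1.1 = (ζ₀.1 s).1.1 ^ k ∧ ((ζ₀ ^ k).1 s).1.2 = 1 := by
  constructor
  · rfl
  · change (ζ₀.1 s).1.2 ^ k = 1
    rw [hζ s, one_zpow]

/-- **In the cyclic group `μ_{N_n}` the elements killed by `N` are exactly the powers of any element of order `N`** (both sets have `N`
elements: `IsCyclic.card_pow_eq_one_le` and `Fintype.card_zpowers`). [cite: MochizukiFrdII2008, Def 2.1 (i) p.16] -/
theorem mem_zpowers_of_pow_eq_one_muN {z x : TateTowerKummerTwist.MuN n} {K : ℕ} (hK : 0 < K) (hz : orderOf z = K)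
    (hx : x ^ K = 1) : x ∈ Subgroup.zpowers z := by
  classical
  -- the `K` powers `z^0, …, z^{K-1}` are distinct, killed by `K`, and there are at most `K` elements killed by `K`
  let P : Finset (TateTowerKummerTwist.MuN n) := (Finset.range K).image fun k => z ^ k
  have hPF : P ⊆ Finset.univ.filter fun a : TateTowerKummerTwist.MuN n => a ^ K = 1 := by
    intro a ha
    obtain ⟨k, -, rfl⟩ := Finset.mem_image.mp ha
    exact Finset.mem_filter.mpr ⟨Finset.mem_univ _, by rw [← pow_mul, mul_comm, pow_mul, ← hz, pow_orderOf_eq_one, one_pow]⟩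
  have hPcard : P.card = K := by
    rw [Finset.card_image_of_injOn, Finset.card_range]
    intro a ha b hb hab
    exact pow_injOn_Iio_orderOf (Set.mem_Iio.mpr (hz ▸ Finset.mem_range.mp (Finset.mem_coe.mp ha)))
      (Set.mem_Iio.mpr (hz ▸ Finset.mem_range.mp (Finset.mem_coe.mp hb))) hab
  have hFP := Finset.eq_of_subset_of_card_le hPF (by rw [hPcard]; exact IsCyclic.card_pow_eq_one_le hK)
  have hxP : x ∈ P := by
    rw [hFP]
    exact Finset.mem_filter.mpr ⟨Finset.mem_univ _, hx⟩
  obtain ⟨k, -, hk⟩ := Finset.mem_image.mp hxP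
  exact hk ▸ Subgroup.npow_mem_zpowers z k

/-- **A `μ`-valued family `ζ₀` whose root of unity at `s₀` has order `N` GENERATES the `N`-torsion of `B₀(S)`** (`S` connected).
[cite: MochizukiFrdII2008, Def 2.1 (i) p.16] -/
theorem mem_zpowers_of_pow_eq_one (hS : isConnectedGSet S) (s₀ : S.V) {ζ₀ : (towerC₃sf.act n).bZero S} (hζ : ∀ s, (ζ₀.1 s).1.2 = 1)
    {K : ℕ} (hK : 0 < K) (hord : orderOf (ζ₀.1 s₀).1.1 = K) {b : (towerC₃sf.act n).bZero S} (hb : b ^ K = 1) :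
    b ∈ Subgroup.zpowers ζ₀ := by
  have hbμ := snd_eq_one_of_pow_eq_one n hK hb
  have hx : (b.1 s₀).1.1 ^ K = 1 := congrArg (fun c : (towerC₃sf.act n).bZero S => ((c.1 s₀).1.1 : TateTowerKummerTwist.MuN n)) hb
  obtain ⟨k, hk⟩ := Subgroup.mem_zpowers_iff.mp (mem_zpowers_of_pow_eq_one_muN n hK hord hx)
  refine Subgroup.mem_zpowers_iff.mpr ⟨k, eq_of_snd_eq_one_of_fst_eq n hS s₀ (fun s => (zpow_apply_fst n hζ k s).2) hbμ ?_⟩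
  rw [(zpow_apply_fst n hζ k s₀).1, hk]

/-- The order of a `μ`-valued family is the order of its root of unity at any point of a connected `S`. [cite: MochizukiEtTh2009, §1 p.13] -/
theorem orderOf_eq_orderOf_fst (hS : isConnectedGSet S) (s₀ : S.V) {ζ₀ : (towerC₃sf.act n).bZero S} (hζ : ∀ s, (ζ₀.1 s).1.2 = 1) :
    orderOf ζ₀ = orderOf (ζ₀.1 s₀).1.1 := by
  -- `ζ₀ ↦ (ζ₀ s₀).1.1` is an injective homomorphism on the `μ`-valued families; compare `k`-th powers being trivial
  refine Nat.dvd_antisymm (orderOf_dvd_iff_pow_eq_one.mpr ?_) (orderOf_dvd_iff_pow_eq_one.mpr ?_)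
  · -- `ζ₀ ^ ord = 1`: both sides `μ`-valued with the same `μ`-coordinate at `s₀`
    refine (zpow_natCast ζ₀ _).symm.trans (eq_of_snd_eq_one_of_fst_eq n hS s₀ (fun s => (zpow_apply_fst n hζ _ s).2)
      (fun _ => rfl) ?_)
    rw [(zpow_apply_fst n hζ _ s₀).1, zpow_natCast, pow_orderOf_eq_one]
    rfl
  · exact congrArg (fun c : (towerC₃sf.act n).bZero S => ((c.1 s₀).1.1 : TateTowerKummerTwist.MuN n)) (pow_orderOf_eq_one ζ₀)

/-- **(M3) THE `N`-TORSION OF `B₀(S)` IS CYCLIC OF ORDER `N`, GENERATED BY A `μ`-VALUED UNIT** — whenever the stabiliser of a point `s₀` of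
the connected covering `S` fixes some `μ`-valued value `x₁` whose root of unity has order divisible by `N`: `ζ₀ := s ↦ g_s · x₁^{ord/N}`
(§0) is `μ`-valued, `div₀ ζ₀ = 1`, `orderOf ζ₀ = N`, and every `b ∈ B₀(S)` with `b^N = 1` is a power of `ζ₀` — verbatim the inputs
(`hζ1`, `hord`, `hgen`) of abc-iut-w6-d037's `isMuSaturated_of_bZero_generator`. [cite: MochizukiEtTh2009, Def 4.1 (iv) p.87] -/
theorem exists_generator_of_fixed (hS : isConnectedGSet S) (s₀ : S.V) (x₁ : (towerC₃sf.Z n).Fn) (hx₁ : x₁.1.2 = 1)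
    (hfix : ∀ g : Compat 3 thetaShear, S.ρ g s₀ = s₀ → (towerC₃sf.act n).actFn g x₁ = x₁) {K : ℕ} (hK : 0 < K)
    (hdvd : K ∣ orderOf x₁.1.1) :
    ∃ ζ₀ : (towerC₃sf.act n).bZero S, (∀ s, (ζ₀.1 s).1.2 = 1) ∧ (towerC₃sf.act n).divZeroHom S ζ₀ = 1 ∧ orderOf ζ₀ = K ∧
      ∀ b : (towerC₃sf.act n).bZero S, b ^ K = 1 → b ∈ Subgroup.zpowers ζ₀ := by
  -- the value `x₁ ^ (ord / N)`: `μ`-valued, of order `N`, fixed by the stabiliser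
  set e : ℕ := orderOf x₁.1.1 / K with he
  have hxe2 : (x₁ ^ e).1.2 = 1 := by
    change x₁.1.2 ^ e = 1
    rw [hx₁, one_pow]
  have hxe1 : (x₁ ^ e).1.1 = x₁.1.1 ^ e := rfl
  have hord0 : orderOf x₁.1.1 ≠ 0 := (orderOf_pos x₁.1.1).ne'
  have horde : orderOf (x₁ ^ e).1.1 = K := by rw [hxe1, he, orderOf_pow_orderOf_div hord0 hdvd]
  have hfixe : ∀ g : Compat 3 thetaShear, S.ρ g s₀ = s₀ → (towerC₃sf.act n).actFn g (x₁ ^ e) = x₁ ^ e := fun g hg => by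
    rw [map_pow, hfix g hg]
  obtain ⟨ζ₀, hζ₀⟩ := (towerC₃sf.act n).exists_bZero_of_invariant hS s₀ (f := x₁ ^ e) trivial hfixe
  -- `ζ₀` is `μ`-valued everywhere: its values are translates of `x₁ ^ e`
  have hζμ : ∀ s, (ζ₀.1 s).1.2 = 1 := fun s => by
    obtain ⟨g, rfl⟩ := hS.2 s₀ s
    rw [ζ₀.2.2 g s₀, hζ₀]
    exact actFn_snd_eq_one n g _ hxe2
  have hordζ : orderOf (ζ₀.1 s₀).1.1 = K := by rw [hζ₀, horde]
  exact ⟨ζ₀, hζμ, divZeroHom_eq_one_of_snd_eq_one n hζμ, (orderOf_eq_orderOf_fst n hS s₀ hζμ).trans hordζ,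
    fun b hb => mem_zpowers_of_pow_eq_one n hS s₀ hζμ hK hordζ hb⟩

/-- **(M3) in UNITS form** (the shape abc-iut-w6-d037's `isMuSaturated_of_bZero_generator` consumes, read in the group `B₀(S)`): a unit
`u` of `B₀(S)` with `div₀ u = 1`, `orderOf u = K`, generating the `K`-torsion of `B₀(S)ˣ`. [cite: MochizukiEtTh2009, Def 4.1 (iv) p.87] -/
theorem exists_units_generator_of_fixed (hS : isConnectedGSet S) (s₀ : S.V) (x₁ : (towerC₃sf.Z n).Fn) (hx₁ : x₁.1.2 = 1)
    (hfix : ∀ g : Compat 3 thetaShear, S.ρ g s₀ = s₀ → (towerC₃sf.act n).actFn g x₁ = x₁) {K : ℕ} (hK : 0 < K)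
    (hdvd : K ∣ orderOf x₁.1.1) :
    ∃ u : (↥((towerC₃sf.act n).bZero S))ˣ, (towerC₃sf.act n).divZeroHom S (u : ↥((towerC₃sf.act n).bZero S)) = 1 ∧ orderOf u = K ∧
      ∀ b : (↥((towerC₃sf.act n).bZero S))ˣ, b ^ K = 1 → b ∈ Subgroup.zpowers u := by
  obtain ⟨ζ₀, -, hdiv, hord, hgen⟩ := exists_generator_of_fixed n hS s₀ x₁ hx₁ hfix hK hdvd
  refine ⟨toUnits ζ₀, hdiv, (orderOf_injective toUnits.toMonoidHom toUnits.injective ζ₀).trans hord, fun b hb => ?_⟩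
  have hb' : (b : ↥((towerC₃sf.act n).bZero S)) ^ K = 1 := by
    rw [← Units.val_pow_eq_pow_val, hb, Units.val_one]
  obtain ⟨k, hk⟩ := Subgroup.mem_zpowers_iff.mp (hgen _ hb')
  refine Subgroup.mem_zpowers_iff.mpr ⟨k, ?_⟩
  rw [← map_zpow, hk]
  exact toUnits_val_apply b

/-- The generator `ζ_{N_n} = (1 mod N_n, 1)` of the level-`n` roots of unity, as an ε-free function, has order `N_n = (n+1)!`.
[cite: MochizukiEtTh2009, §1 p.13] -/
theorem orderOf_zeta_one :
    orderOf (⟨zeta (TateTowerKummerTwist.MuN n) (Multiplicative.ofAdd (1 : ZMod (N n))), rfl⟩ : (towerC₃sf.Z n).Fn).1.1 = ((N n : ℕ+) : ℕ) := by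
  change orderOf (Multiplicative.ofAdd (1 : ZMod (N n))) = _
  rw [orderOf_ofAdd_eq_addOrderOf, ZMod.addOrderOf_one, TateTowerKummerTwist.coe_N]

end Level

/-! ## §3 The covering `Y_n = Compat₃′/V_n` and the `μ_N`-saturated objects of the fourth model -/

/-- **At abc-iut-L1-t6's covering `Y_n = Compat₃′/V_n` (level EXACTLY `n`, `V_n` acting trivially on every level-`n` function) the
`N`-torsion of `B₀(Y_n)` is cyclic of order `N` for EVERY `N ∣ N_n = (n+1)!`**, generated by a `μ`-valued unit of trivial divisor.
[cite: MochizukiEtTh2009, Def 4.1 (iv) p.87] -/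
theorem exists_generator_cover_vSub (n : ℕ) {K : ℕ} (hK : 0 < K) (hdvd : K ∣ ((N n : ℕ+) : ℕ)) :
    ∃ (Y : ConnectedPart (BTemp (Compat 3 thetaShear))), lvlC 3 thetaShear Y = n ∧
      ∃ ζ₀ : (towerC₃sf.act n).bZero (gset Y), (∀ s, (ζ₀.1 s).1.2 = 1) ∧ (towerC₃sf.act n).divZeroHom (gset Y) ζ₀ = 1 ∧
        orderOf ζ₀ = K ∧ ∀ b : (towerC₃sf.act n).bZero (gset Y), b ^ K = 1 → b ∈ Subgroup.zpowers ζ₀ := by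
  obtain ⟨Y, y₀, hlvl, htrans, hstab, -⟩ := exists_cover_vSub n
  refine ⟨Y, hlvl, ?_⟩
  have hS : isConnectedGSet (gset Y) := isConnectedGSet_gset Y
  refine exists_generator_of_fixed n hS y₀ ⟨zeta (TateTowerKummerTwist.MuN n) (Multiplicative.ofAdd (1 : ZMod (N n))), rfl⟩ rfl
    (fun g hg => ?_) hK (by rwa [orderOf_zeta_one])
  rw [towerC₃sf_actFn_eq_one_of_mem_vSub le_rfl ((hstab g).1 hg), MulAut.one_apply]

variable (R S : ((ConnectedPart (BTemp (Compat 3 thetaShear)))ᵒᵖ ⥤ CommMonCat.{0}) → Prop)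

/-- **Def. 4.1 (iv) at the fourth model: an object `A` is `μ_N`-SATURATED as soon as the stabiliser of one point of its base covering fixes
a `μ`-valued value whose root of unity has order divisible by `N`** (abc-iut-w6-d037's `isMuSaturated_of_bZero_generator` fed with (M3);
`Φ(A^bs)` divisorial because the fourth model is a Frobenioid). [cite: MochizukiEtTh2009, Def 4.1 (iv) p.87] -/
theorem isMuSaturated_of_fixed (A : (ThetaTwistTowerTempered.temperedFrobenioid R S).category) (s₀ : (gset A.base).V)
    (x₁ : (towerC₃sf.Z (lvlC 3 thetaShear A.base)).Fn) (hx₁ : x₁.1.2 = 1)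
    (hfix : ∀ g : Compat 3 thetaShear, (gset A.base).ρ g s₀ = s₀ → (towerC₃sf.act (lvlC 3 thetaShear A.base)).actFn g x₁ = x₁)
    (N : ℕ+) (hdvd : (N : ℕ) ∣ orderOf x₁.1.1) :
    (ThetaTwistTowerTempered.temperedFrobenioid R S).IsMuSaturated A N := by
  obtain ⟨u, hdiv, hord, hgen⟩ :=
    exists_units_generator_of_fixed (lvlC 3 thetaShear A.base) (isConnectedGSet_gset A.base) s₀ x₁ hx₁ hfix N.pos hdvd
  -- `B₀^Λ(A^bs)` of the weak type-`ℤ` data IS the group `B₀(A^bs)`; read `div₀ u = 1` there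
  have hdiv' : dm.div₀ ((ThetaTwistTowerTempered.temperedFrobenioid R S).baseOp (op A.base))
      (u : ↥((towerC₃sf.act (lvlC 3 thetaShear A.base)).bZero (gset A.base))) = 1 := hdiv
  refine (ThetaTwistTowerTempered.temperedFrobenioid R S).isMuSaturated_of_bZero_generator A
    (TemperedFrobenioid.isDivisorial_divisorMonoid_of_isFrobenioid (isFrobenioid_temperedFrobenioid R S) A.base) N u ?_ hord
    (fun b _ hb => hgen b hb)
  rw [RealifiedDivisorMonoids.ofRlfZWeak_divΛ_apply]
  change EtaleTheta.gpMap _ (dm.div₀ ((ThetaTwistTowerTempered.temperedFrobenioid R S).baseOp (op A.base))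
    (u : ↥((towerC₃sf.act (lvlC 3 thetaShear A.base)).bZero (gset A.base)))) = 1
  rw [hdiv']
  exact map_one _

/-- **EVERY object of the fourth model over a covering whose point-stabiliser lies in abc-iut-L1-t6's `V_m` (`m ≥` the level) is
`μ_N`-SATURATED for every `N ∣ N_{lvl} = (lvl+1)!`** — in particular every object over `Y_n = Compat₃′/V_n` (`exists_cover_vSub`: level
`n`, stabiliser `V_n`; e.g. the Frobenius-trivial object `(Y_n, 0)`) is `μ_N`-saturated for all `N ∣ (n+1)!`: Def. 4.1 (iv) is NON-VACUOUS at
a tower model of record, for every `N ≥ 1`. [cite: MochizukiEtTh2009, Def 4.1 (iv) p.87] -/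
theorem isMuSaturated_of_stabilizer_le_vSub (A : (ThetaTwistTowerTempered.temperedFrobenioid R S).category) (s₀ : (gset A.base).V)
    {m : ℕ} (hm : lvlC 3 thetaShear A.base ≤ m) (hstab : ∀ g : Compat 3 thetaShear, (gset A.base).ρ g s₀ = s₀ → g ∈ vSub 3 thetaShear m)
    (N : ℕ+) (hdvd : (N : ℕ) ∣ ((TateTowerKummerTwist.N (lvlC 3 thetaShear A.base) : ℕ+) : ℕ)) :
    (ThetaTwistTowerTempered.temperedFrobenioid R S).IsMuSaturated A N := by
  refine isMuSaturated_of_fixed R S A s₀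
    ⟨zeta (TateTowerKummerTwist.MuN (lvlC 3 thetaShear A.base))
      (Multiplicative.ofAdd (1 : ZMod (TateTowerKummerTwist.N (lvlC 3 thetaShear A.base)))), rfl⟩ rfl (fun g hg => ?_) N
    (by rwa [orderOf_zeta_one])
  rw [towerC₃sf_actFn_eq_one_of_mem_vSub hm (hstab g hg), MulAut.one_apply]

end ThetaTwistTowerTempered

end Literature.AnabelianGeometry.EtaleTheta

end
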